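import Literature.NumberTheory.EllipticCurves.PAdicTwoVariableTransform
import HarnessLib

/-!
# Weighted sums of two-variable Amice transforms (Teichmüller branches, abstract form)

The two-variable `p`-adic `L`-function of a Hida family on the even Teichmüller branch `ω^c`
(Greenberg–Stevens 1993, Thm. 5.15; Kitagawa 1994, Thm. 1.1; Delbourgo 2008, Thm. 4.11, Def. 4.12)
is, in Teichmüller–`γ` class coordinates `x = η_x γ^t`, `z = η_z γ^s` on `ℤ_p^× × ℤ_p^×`, the
finite weighted sum `F_c = Σ_{(η_z, η_x)} η_x^c · 𝓐(μ^{η_z, η_x})` of the two-variable Amice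
transforms (`PAdicTwoVariableTransform.lean`) of the class-coordinate pieces `μ^{η_z,η_x}` of
Kitagawa's measure.  This file treats such weighted sums ABSTRACTLY — a finite family
`μ : ι → BoundedDistribution (ℤ_p × ℤ_p)` and weights `w : ι → ℚ_p` — and proves what the
interpolation formula needs:

* `BoundedDistribution.transformSum μ w = Σ_i C(w i) · 𝓐(μ i)`;
* `isPadicInt_transformSum` — integrality for `‖μ i‖ ≤ 1`, `‖w i‖ ≤ 1`;
* `padicEval₂_transformSum` — `(Σ_i w_i 𝓐(μ i))(u, v) = Σ_i w_i · 𝓐(μ i)(u, v)` on the open unit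
  polydisc (evaluation is additive and multiplicative on integral series, tree
  `padicEval₂_add` / `padicEval₂_mul` / `padicEval₂_C`);
* `tendsto_sum_mul_sum_mul_pow_padicEval₂_transformSum` — at `(γ^a − 1, γ^b − 1)` for a principal
  unit `γ` the value is `lim_n Σ_i w_i Σ_{(x,y) mod p^n} (μ i)_n(x, y) γ^{a x} γ^{b y}`
  (from `tendsto_sum_mul_pow_padicEval₂_transform`).

Brick B1c of the bottom-up plan recorded with the named fact
`greenbergStevens_kitagawa_twoVariable_interpolation_allBranches`; the specialisation `ι = μ_τ × μ_τ`,
`w (η_z, η_x) = η_x^c`, and the passage from box coordinates on `ℤ_p^× × ℤ_p^×` to class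
coordinates (tree `finsum_sum_classes_eq_sum_units`) are the next brick.  Everything is proved; no
named facts.

## References

* B. Mazur, J. Tate, J. Teitelbaum, Invent. Math. 84 (1986), §I.13. [MazurTateTeitelbaum1986Invent]
* D. Delbourgo, *Elliptic Curves and Big Galois Representations* (2008), Thm. 4.11, Def. 4.12, p. 99.
  [Delbourgo2008]
-/

noncomputable section

open Filter Topology

namespace Literature.NumberTheory.EllipticCurves

variable {p : ℕ} [Fact p.Prime]

/-! ### `padicEval₂` on finite sums of integral series -/

section EvalSums

/-- `padicEval₂ 0 = 0`. [folklore] -/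
theorem padicEval₂_zero' (u v : ℚ_[p]) : padicEval₂ (0 : MvPowerSeries (Fin 2) ℚ_[p]) u v = 0 := by
  rw [← map_zero (MvPowerSeries.C (σ := Fin 2) (R := ℚ_[p])), padicEval₂_C]

/-- A finite sum of integral series is integral. [folklore] -/
theorem isPadicInt_finsetSum_fin_two {ι : Type*} (s : Finset ι) {F : ι → MvPowerSeries (Fin 2) ℚ_[p]}
    (hF : ∀ i ∈ s, IsPadicInt (F i)) : IsPadicInt (∑ i ∈ s, F i) := by
  classical
  induction s using Finset.induction_on with
  | empty => simp only [Finset.sum_empty]; exact IsPadicInt.zero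
  | insert a s ha ih =>
    rw [Finset.sum_insert ha]
    exact (hF a (Finset.mem_insert_self a s)).add (ih fun i hi => hF i (Finset.mem_insert_of_mem hi))

/-- **`padicEval₂` is additive over finite sums of integral series** on the open unit polydisc.
[folklore] -/
theorem padicEval₂_finset_sum {ι : Type*} (s : Finset ι) {F : ι → MvPowerSeries (Fin 2) ℚ_[p]}
    (hF : ∀ i ∈ s, IsPadicInt (F i)) {u v : ℚ_[p]} (hu : ‖u‖ < 1) (hv : ‖v‖ < 1) :
    padicEval₂ (∑ i ∈ s, F i) u v = ∑ i ∈ s, padicEval₂ (F i) u v := by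
  classical
  induction s using Finset.induction_on with
  | empty => simp only [Finset.sum_empty]; exact padicEval₂_zero' u v
  | insert a s ha ih =>
    have hs : ∀ i ∈ s, IsPadicInt (F i) := fun i hi => hF i (Finset.mem_insert_of_mem hi)
    rw [Finset.sum_insert ha, Finset.sum_insert ha,
      padicEval₂_add (hF a (Finset.mem_insert_self a s)) (isPadicInt_finsetSum_fin_two s hs) hu hv, ih hs]

/-- `(C w · F)(u, v) = w · F(u, v)` for `F` integral and `‖w‖ ≤ 1`. [folklore] -/
theorem padicEval₂_C_mul {F : MvPowerSeries (Fin 2) ℚ_[p]} (hF : IsPadicInt F) {w : ℚ_[p]}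
    (hw : ‖w‖ ≤ 1) {u v : ℚ_[p]} (hu : ‖u‖ < 1) (hv : ‖v‖ < 1) :
    padicEval₂ (MvPowerSeries.C w * F) u v = w * padicEval₂ F u v := by
  rw [padicEval₂_mul (IsPadicInt.C hw) hF hu hv, padicEval₂_C]

end EvalSums

/-! ### Weighted sums of transforms -/

namespace BoundedDistribution

variable {ι : Type*} [Fintype ι] (μ : ι → BoundedDistribution (padicIntSq p) ℚ_[p]) (w : ι → ℚ_[p])

/-- The **weighted sum of two-variable Amice transforms** `Σ_i C(w i) · 𝓐(μ i)` — the shape of the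
branch series `F_c = Σ_{(η_z,η_x)} η_x^c 𝓐(μ^{η_z,η_x})` of a measure on `ℤ_p^× × ℤ_p^×` read in
Teichmüller–`γ` class coordinates (Delbourgo 2008, Def. 4.12 with `ψ = ω^{-c}`).
[cite: Delbourgo2008, Def. 4.12] -/
def transformSum : MvPowerSeries (Fin 2) ℚ_[p] := ∑ i, MvPowerSeries.C (w i) * (μ i).transform

/-- Unfolding lemma for `transformSum`. [folklore] -/
theorem transformSum_def : transformSum μ w = ∑ i, MvPowerSeries.C (w i) * (μ i).transform := rfl

/-- **Integrality of the weighted sum** for `‖μ i‖ ≤ 1` and `‖w i‖ ≤ 1`. [folklore] -/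
theorem isPadicInt_transformSum (hμ : ∀ i, (μ i).bound ≤ 1) (hw : ∀ i, ‖w i‖ ≤ 1) :
    IsPadicInt (transformSum μ w) :=
  isPadicInt_finsetSum_fin_two _ fun i _ => (IsPadicInt.C (hw i)).mul ((μ i).isPadicInt_transform (hμ i))

/-- **Evaluation of the weighted sum**: `(Σ_i w_i 𝓐(μ i))(u, v) = Σ_i w_i · 𝓐(μ i)(u, v)` on the
open unit polydisc. [folklore] -/
theorem padicEval₂_transformSum (hμ : ∀ i, (μ i).bound ≤ 1) (hw : ∀ i, ‖w i‖ ≤ 1) {u v : ℚ_[p]}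
    (hu : ‖u‖ < 1) (hv : ‖v‖ < 1) :
    padicEval₂ (transformSum μ w) u v = ∑ i, w i * padicEval₂ (μ i).transform u v := by
  rw [transformSum_def, padicEval₂_finset_sum _ (fun i _ =>
    (IsPadicInt.C (hw i)).mul ((μ i).isPadicInt_transform (hμ i))) hu hv]
  exact Finset.sum_congr rfl fun i _ =>
    padicEval₂_C_mul ((μ i).isPadicInt_transform (hμ i)) (hw i) hu hv

/-- **Evaluation of the weighted sum as an integral**:
`(Σ_i w_i 𝓐(μ i))(u, v) = Σ_i w_i ∫ (1+u)^s (1+v)^t d(μ i)` for `u, v ∈ ℤ_p` of norm `< 1`.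
[folklore] -/
theorem padicEval₂_transformSum_eq_sum_integral (hμ : ∀ i, (μ i).bound ≤ 1) (hw : ∀ i, ‖w i‖ ≤ 1)
    {u v : ℤ_[p]} (hu : ‖u‖ < 1) (hv : ‖v‖ < 1) :
    padicEval₂ (transformSum μ w) u v = ∑ i, w i * (μ i).integral (binomKernel₂ u v) := by
  have hu' : ‖(u : ℚ_[p])‖ < 1 := by rwa [PadicInt.padic_norm_e_of_padicInt]
  have hv' : ‖(v : ℚ_[p])‖ < 1 := by rwa [PadicInt.padic_norm_e_of_padicInt]
  rw [padicEval₂_transformSum μ w hμ hw hu' hv']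
  exact Finset.sum_congr rfl fun i _ => by rw [(μ i).padicEval₂_transform (hμ i) hu hv]

/-- **The values of the weighted sum at `(γ^a − 1, γ^b − 1)` are limits of weighted Riemann sums**
`Σ_i w_i Σ_{(x,y) mod p^n} (μ i)_n(x, y) γ^{a·x} γ^{b·y}` (`γ` a principal unit, representatives
`x.val, y.val ∈ ℕ`), for `‖μ i‖ ≤ 1`, `‖w i‖ ≤ 1` (Mazur–Tate–Teitelbaum 1986, §I.13, in two
variables and on all branches at once). [cite: MazurTateTeitelbaum1986Invent, §I.13] -/
theorem tendsto_sum_mul_sum_mul_pow_padicEval₂_transformSum (hμ : ∀ i, (μ i).bound ≤ 1)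
    (hw : ∀ i, ‖w i‖ ≤ 1) {γ : ℤ_[p]} (hγ : ‖γ - 1‖ < 1) (a b : ℕ) :
    Tendsto (fun n : ℕ => ∑ i, w i * ∑ c : ZMod (p ^ n) × ZMod (p ^ n),
        (μ i).μ n c * ((γ : ℚ_[p]) ^ (a * c.1.val) * (γ : ℚ_[p]) ^ (b * c.2.val)))
      atTop (𝓝 (padicEval₂ (transformSum μ w) ((γ : ℚ_[p]) ^ a - 1) ((γ : ℚ_[p]) ^ b - 1))) := by
  have hu : ‖((γ : ℚ_[p]) ^ a - 1)‖ < 1 := by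
    have h := norm_pow_sub_one_lt_one hγ a
    rwa [← PadicInt.padic_norm_e_of_padicInt, PadicInt.coe_sub, PadicInt.coe_pow, PadicInt.coe_one] at h
  have hv : ‖((γ : ℚ_[p]) ^ b - 1)‖ < 1 := by
    have h := norm_pow_sub_one_lt_one hγ b
    rwa [← PadicInt.padic_norm_e_of_padicInt, PadicInt.coe_sub, PadicInt.coe_pow, PadicInt.coe_one] at h
  rw [padicEval₂_transformSum μ w hμ hw hu hv]
  exact tendsto_finsetSum _ fun i _ =>
    ((μ i).tendsto_sum_mul_pow_padicEval₂_transform (hμ i) hγ a b).const_mul (w i)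

end BoundedDistribution

end Literature.NumberTheory.EllipticCurves

end
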